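import Mathlib

/-!
# A hub forces one good common value

Crux `Summit.MatrixMultiplication.MatrixMultiplication.Theses.SnSubsetDichotomy.PolynomialSlack`
(item `stmt-MatrixMultiplication-8306`), level-one programme, line transport-split-hull (lead c6):
from a hub to a single GOOD COMMON VALUE. At a hub position `k` of a TPP triple `(S,T,U)` one has a
probability vector `μ` over the `n` values (`μ(v) = P(u k = v)`), and two `[0,1]`-valued profiles
`X(v) = P_T(t⁻¹ v ∈ J)`, `Y(v) = P_S(s⁻¹ v ∈ I)`; the heavy masses give `E_μ X ≥ σ`, `E_μ Y ≥ ρ` with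
`σ + ρ - 1 ≥ 1/(4Λ)` (the hub inequality), and the forced-hits bound gives `Σ_v X(v) Y(v) ≤ Z`.
Conclusion (`exists_good_value`): one value `v` carries `μ(v) X(v) Y(v) ≥ 1/(64 Λ² Z)`.

Proof. Pointwise `X Y ≥ X + Y - 1` (as `(1 - X)(1 - Y) ≥ 0`), so
`Σ μXY ≥ Σ μX + Σ μY - Σ μ ≥ σ + ρ - 1 ≥ 1/(4Λ) = 2q`, `q := 1/(8Λ)`. Let `m := max_v μXY`. Pointwise
`μXY ≤ (m/q)·XY + q·μ` (if `XY ≥ q` then `μXY ≤ m ≤ m·XY/q`; otherwise `μXY ≤ μ q`), and summing,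
`2q ≤ Σ μXY ≤ (m/q) Z + q`, i.e. `q² ≤ m Z`, `m ≥ q²/Z = 1/(64 Λ² Z)`.
-/

namespace Summit.MatrixMultiplication.MatrixMultiplication.Theorems.PolynomialSlack

set_option linter.dupNamespace false

open scoped BigOperators

/-- **A hub forces one good common value.** For a probability vector `μ` on a finite type, profiles
`X, Y` with values in `[0,1]`, `Λ ≥ 1`, `Z > 0`, if `Σ μX ≥ σ`, `Σ μY ≥ ρ`, `σ + ρ - 1 ≥ 1/(4Λ)` and
`Σ XY ≤ Z`, then some `v` has `μ(v) X(v) Y(v) ≥ 1/(64 Λ² Z)`.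
Proof: `XY ≥ X + Y - 1` gives `Σ μXY ≥ 2q`, `q = 1/(8Λ)`; with `m = max μXY`, pointwise
`μXY ≤ (m/q) XY + q μ`, so `2q ≤ (m/q) Z + q` and `m ≥ q²/Z`. [folklore] -/
theorem exists_good_value {ι : Type*} [Fintype ι] (μ X Y : ι → ℝ) (Λ Z σ ρ : ℝ)
    (hμ0 : ∀ v, 0 ≤ μ v) (hμ1 : ∑ v, μ v = 1) (hX0 : ∀ v, 0 ≤ X v) (hX1 : ∀ v, X v ≤ 1)
    (hY0 : ∀ v, 0 ≤ Y v) (hY1 : ∀ v, Y v ≤ 1) (hΛ : 1 ≤ Λ) (hZ : 0 < Z)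
    (hσ : σ ≤ ∑ v, μ v * X v) (hρ : ρ ≤ ∑ v, μ v * Y v) (hhub : 1 / (4 * Λ) ≤ σ + ρ - 1)
    (hforced : ∑ v, X v * Y v ≤ Z) : ∃ v, 1 / (64 * Λ ^ 2 * Z) ≤ μ v * X v * Y v := by
  classical
  -- the index type is nonempty, as `μ` has total mass one
  have hne : (Finset.univ : Finset ι).Nonempty := by
    by_contra h
    rw [Finset.not_nonempty_iff_eq_empty] at h
    rw [h, Finset.sum_empty] at hμ1
    exact zero_ne_one hμ1
  -- a maximiser `v₀` of `μ X Y`, with maximum `m`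
  obtain ⟨v₀, -, hv₀⟩ := Finset.exists_max_image Finset.univ (fun v => μ v * X v * Y v) hne
  refine ⟨v₀, ?_⟩
  set m : ℝ := μ v₀ * X v₀ * Y v₀ with hm_def
  have hm : ∀ v, μ v * X v * Y v ≤ m := fun v => hv₀ v (Finset.mem_univ v)
  have hm0 : 0 ≤ m := mul_nonneg (mul_nonneg (hμ0 v₀) (hX0 v₀)) (hY0 v₀)
  -- the scale `q = 1/(8Λ)`
  have hΛ0 : 0 < Λ := by linarith
  have hΛne : Λ ≠ 0 := hΛ0.ne'
  set q : ℝ := 1 / (8 * Λ) with hq_def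
  have hq0 : 0 < q := by rw [hq_def]; positivity
  have hqne : q ≠ 0 := hq0.ne'
  -- pointwise: `μXY ≤ (m/q)·XY + q·μ`
  have hpt : ∀ v, μ v * X v * Y v ≤ m / q * (X v * Y v) + q * μ v := by
    intro v
    have hXY0 : 0 ≤ X v * Y v := mul_nonneg (hX0 v) (hY0 v)
    rcases le_or_gt q (X v * Y v) with h | h
    · have h1 : μ v * X v * Y v ≤ m := hm v
      have h2 : m ≤ m / q * (X v * Y v) := by
        rw [div_mul_eq_mul_div, le_div_iff₀ hq0]
        exact mul_le_mul_of_nonneg_left h hm0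
      have h3 : 0 ≤ q * μ v := mul_nonneg hq0.le (hμ0 v)
      linarith
    · have h1 : μ v * X v * Y v ≤ q * μ v := by
        rw [mul_assoc, mul_comm q]
        exact mul_le_mul_of_nonneg_left h.le (hμ0 v)
      have h2 : 0 ≤ m / q * (X v * Y v) := mul_nonneg (div_nonneg hm0 hq0.le) hXY0
      linarith
  -- lower bound: `2q ≤ Σ μXY`
  have hlow : 2 * q ≤ ∑ v, μ v * X v * Y v := by
    have h1 : ∀ v, μ v * (X v + Y v - 1) ≤ μ v * X v * Y v := by
      intro v
      have : X v + Y v - 1 ≤ X v * Y v := by nlinarith [hX1 v, hY1 v]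
      calc μ v * (X v + Y v - 1) ≤ μ v * (X v * Y v) := mul_le_mul_of_nonneg_left this (hμ0 v)
        _ = μ v * X v * Y v := by ring
    have h2 : ∑ v, μ v * (X v + Y v - 1) ≤ ∑ v, μ v * X v * Y v :=
      Finset.sum_le_sum fun v _ => h1 v
    have h3 : ∑ v, μ v * (X v + Y v - 1) = ∑ v, μ v * X v + ∑ v, μ v * Y v - ∑ v, μ v := by
      rw [← Finset.sum_add_distrib, ← Finset.sum_sub_distrib]
      exact Finset.sum_congr rfl fun v _ => by ring
    have h4 : 2 * q = 1 / (4 * Λ) := by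
      rw [hq_def]; field_simp; ring
    rw [h4]
    linarith [hhub, hσ, hρ, hμ1, h2, h3]
  -- upper bound: `Σ μXY ≤ (m/q) Z + q`
  have hup : ∑ v, μ v * X v * Y v ≤ m / q * Z + q := by
    calc ∑ v, μ v * X v * Y v ≤ ∑ v, (m / q * (X v * Y v) + q * μ v) :=
          Finset.sum_le_sum fun v _ => hpt v
      _ = m / q * ∑ v, X v * Y v + q * ∑ v, μ v := by
          rw [Finset.sum_add_distrib, Finset.mul_sum, Finset.mul_sum]
      _ ≤ m / q * Z + q := by
          rw [hμ1, mul_one]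
          have : m / q * ∑ v, X v * Y v ≤ m / q * Z :=
            mul_le_mul_of_nonneg_left hforced (div_nonneg hm0 hq0.le)
          linarith
  -- combine: `q² ≤ m Z`
  have hkey : q * q ≤ m * Z := by
    have h1 : q ≤ m / q * Z := by linarith
    calc q * q ≤ q * (m / q * Z) := mul_le_mul_of_nonneg_left h1 hq0.le
      _ = m * Z := by field_simp
  -- conclude: `1/(64 Λ² Z) = q²/Z ≤ m`
  have h64 : q * q * (64 * Λ ^ 2) = 1 := by
    rw [hq_def]; field_simp; ring
  have hpos : 0 < 64 * Λ ^ 2 * Z := by positivity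
  rw [div_le_iff₀ hpos]
  calc (1 : ℝ) = q * q * (64 * Λ ^ 2) := h64.symm
    _ ≤ m * Z * (64 * Λ ^ 2) := mul_le_mul_of_nonneg_right hkey (by positivity)
    _ = m * (64 * Λ ^ 2 * Z) := by ring

end Summit.MatrixMultiplication.MatrixMultiplication.Theorems.PolynomialSlack
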